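import Mathlib
import Literature.Geometry.Lorentzian.GiorgiKlainermanSzeftel2022.TransportWeightLedger
import Literature.Geometry.Lorentzian.GiorgiKlainermanSzeftel2022.GRWTransformationAlgebra

/-!
# Giorgi–Klainerman–Szeftel, *Wave equations estimates and the nonlinear stability of slowly rotating Kerr black holes*,
# Part II, Chapter 11 — the `ψ`-side `N`-term ledger: `r`-weights and `a`-orders in the proofs of Lemma 11.2.8 (§11.3) and
# Theorem 11.2.4 (§11.5), the vector fields `T, Z, T̂, R̂, T̂_δ` of §6.1 as used in §11.3.3, and the `|a|`-absorption of
# Theorem 11.2.3, Step 3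

Texts.  `[J]` = the journal version, Pure Appl. Math. Q. **20** (2024), no. 7 (bib key `GiorgiKlainermanSzeftel2024`,
doi:10.4310/pamq.241128023033); a locator `p.N Lm` is line `m` of page `N` of the per-page text of that PDF (printed folio `N − 1`).
`[v1]` = arXiv:2205.14808v1 (bib key `GiorgiKlainermanSzeftel2022`); a locator `l.N` is line `N` of its TeX source
`FinalKerrarxivversion.tex`.  Theorem numbers are `[J]`'s: `[J]` Proposition 11.2.7 / Lemma 11.2.8 / Proposition 11.2.9 are `[v1]`'s
Proposition 11.2.6 / Lemma 11.2.7 / Proposition 11.2.8 (same labels `prop:Step1-psi`, `lemma:decayfortheNterm-psi`,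
`prop:MaiTransportA-steps`).

What this module is.  A LEDGER, in the style of `TransportWeightLedger` (the `A`-side of §11.4) which it imports: every display of
§11.3.1 and of §11.5 Steps 1–3 is an inequality between weighted `L²` integrals, obtained by Cauchy–Schwarz from a pairing and then
dominated by a slot of one of the norms (6.1.12)–(6.1.21) (for `ψ`) or of Definition 11.2.1 / Remark 11.2.2 (for `A`).  We record, as
closed arithmetic over `ℚ`, (i) that the two Cauchy–Schwarz weights add up to twice the pairing weight, (ii) that each resulting weight is
`≤` the weight of the norm slot the text names, with the exact slack, and (iii) where the printed ranges `δ ≤ p ≤ 2 − δ` (Lemma 11.2.8)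
and `−1 + δ ≤ q ≤ 1 − δ` (Theorem 11.2.4) enter.  "Domination at the level of weights" means: the printed integrand exponent is at most the
slot exponent, which is what uniformity as `r → ∞` requires; on bounded-`r` regions (the support of the cut-offs `χ`, `1 − χ_nt`, the
trapping region) every comparison holds with `m`-dependent constants and nothing is recorded.  In addition: §2 certifies from the Kerr
values of `GRWTransformationAlgebra` (imported) that `N₀ = (V − V₀)ψ` carries the factor `a²` EXACTLY, with a leading coefficient that
never vanishes; §3 is the coefficient algebra of the vector fields of Definition 6.1.10, (6.1.9) and Definition 6.1.13 behind the
decomposition "`T = T̂ − a(r²+a²)⁻¹Z = R̂ + Δ(r²+a²)⁻¹e₃ − a(r²+a²)⁻¹Z`" of §11.3.3; §5 is the real-number shape of the absorption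
"as well as the smallness of `|a|/m`" in Step 3 of the proof of Theorem 11.2.3.  LEVELS (the number `s` of `𝔡`-derivatives, the ranges
`s ≤ k_L`, `2 ≤ s ≤ k_L − 1`) are the business of `FullRWInteriorLedger` and are not re-typed here.  Nothing in this module is an estimate:
no function space, no integral, no solution of (11.1.6) occurs; the analytic content of Lemma 11.2.8 and Theorem 11.2.4 (the Morawetz,
`r^p` and energy estimates themselves, the integrations by parts of §11.3.3, the structure of `N_err`) is NOT formalised.

Conventions.  A weight is the total exponent `w` of `r^w` in front of a squared quantity (or of a bilinear pairing).  The weighted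
derivatives are `𝔡 = {∇₃, r∇₄, r∇}` (`[J]` p.142 L27), so `|𝔡f|²` contains `|∇₃f|²`, `r²|∇₄f|²`, `r²|∇f|²` ("inner offsets" `0, 2, 2`).
Slots of the `A`-norms are those of `TransportWeightLedger` (§0 there): `0 = |A|²`, `1 = |∇₃A|²`, `2 = |∇₄A|²`, `3 = |∇A|²`,
`4 = |∇₃∇̌₃A|²`, `5 = |∇₄∇₃A|²`, `6 = |∇∇₃A|²`, `7 = |∇_R̂∇₃A|²`, `8 = χ²_nt|∇₄∇₃A|²`, a table entry `(slot, k)` meaning weight `r^{p+k}`.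

READINGS (ours, flagged `[our reading]` at the declaration): (R1) "`N₀ = O(a r⁻⁴)ψ`" of (11.1.8) and "`N₀ = O(a²r⁻⁴)ψ`" of §11.5
Step 2a are both true size statements for `|a| ≤ m`; the exact factor is `a²` (§2).  (R2) In §11.5 Step 2 the pairing
`r^{q+2} 𝔡^{≤s}ψ̌ · (∇₄ + 3r⁻¹)𝔡^{≤s}N` is rewritten with `r^{q+1}` and one more `𝔡`: `r^{q+2}∇₄ = r^{q+1}(r∇₄)` and `r∇₄ ∈ 𝔡`.
(R3) The printed list "by definition of `N_p^s[ψ, N]`, … `= (Mor)N^s + (ext)N_p^s + (En)N^s`" (`[J]` p.486 L40–47, `[v1]`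
l.20696–20702) names the three pairing summands of (6.1.15) + (6.1.21); the quadratic summands `∫_M |N|²`,
`sup_τ ∫_{Σ(τ)} |N|²`, `∫_{Σ_*} |N|²` and the pairing `∫_{M_notrap} |Dψ||N|` are not named there; §1 records which slots dominate
them (`bulk_quadratic_summands`, `sigma_summand_slots`) and does not adjudicate anything.

Scope / not used.  No `sorry`, no axiom, no analysis.  The module does not decide whether any estimate of Chapter 11 holds.
-/

namespace Literature.Geometry.Lorentzian.GiorgiKlainermanSzeftel2022.NTermWeightLedger

open Literature.Geometry.Lorentzian.GiorgiKlainermanSzeftel2022.TransportWeightLedger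
open Literature.Geometry.Lorentzian.GiorgiKlainermanSzeftel2022.GRWTransformationAlgebra

/-! ## §0 The `ψ`-norm weights of (6.1.12)–(6.1.21) and the two weights of Remark 11.2.2's display -/

/-- (6.1.12): "`Mor[ψ](τ₁,τ₂) := ∫_{M(τ₁,τ₂)} r^{−2}|∇_R̂ψ|² + r^{−3}|ψ|² + ∫_{M_notrap(τ₁,τ₂)} (r^{−2}|∇₃ψ|² + r^{−1}|∇ψ|²)`": the
zeroth-order bulk weight `−3`. [cite: GiorgiKlainermanSzeftel2024, (6.1.12), p.218 L76–93; GiorgiKlainermanSzeftel2022, l.9902–9909] -/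
def morZero : ℚ := -3

/-- (6.1.12): the weight `−2` of `|∇_R̂ψ|²` in `Mor[ψ]`. [cite: GiorgiKlainermanSzeftel2024, (6.1.12), p.218 L76–93; GiorgiKlainermanSzeftel2022, l.9902–9905] -/
def morRhat : ℚ := -2

/-- (6.1.12): "`Morr[ψ](τ₁,τ₂) := Mor[ψ](τ₁,τ₂) + ∫_{M_{r≥4m}(τ₁,τ₂)} r^{−1−δ}|∇₃ψ|²`": the improved `∇₃`-weight `−1−δ` on `r ≥ 4m`.
[cite: GiorgiKlainermanSzeftel2024, (6.1.12), p.218 L87–93; GiorgiKlainermanSzeftel2022, l.9908–9909] -/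
def morrNab3 (δ : ℚ) : ℚ := -1 - δ

/-- Unfolding lemma for `morrNab3`. [cite: GiorgiKlainermanSzeftel2024, (6.1.12), p.218 L87–93] -/
@[simp] lemma morrNab3_def (δ : ℚ) : morrNab3 δ = -1 - δ := rfl

/-- (6.1.16): "`B_p[ψ] := Morr[ψ] + ∫_{M_{r≥4m}} r^{p−3}(|𝔡ψ|² + |ψ|²)`", so on `r ≥ 4m` the bulk weight of `|∇₃ψ|²` is `p − 3 + 0`, of
`|∇₄ψ|²` and `|∇ψ|²` is `p − 3 + 2 = p − 1`, and of `|ψ|²` is `p − 3` (`TransportWeightLedger.bPsiZero`).  We record the weight of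
`|𝔡ψ|²` with a given inner offset. [cite: GiorgiKlainermanSzeftel2024, (6.1.16), p.219 L65–75; GiorgiKlainermanSzeftel2022, l.9939–9941] -/
def bPsiDk (p inner : ℚ) : ℚ := p - 3 + inner

/-- Unfolding lemma for `bPsiDk`. [cite: GiorgiKlainermanSzeftel2024, (6.1.16), p.219 L65–75] -/
@[simp] lemma bPsiDk_def (p inner : ℚ) : bPsiDk p inner = p - 3 + inner := rfl

/-- Remark 11.2.2's display "`∫_{M(τ₁,τ₂)} r^{p+1}(r²|𝔡^{≤s}∇₃A|² + |𝔡^{≤s}A|²) ≲ B^{s−1}_p[A]`": the weight `p + 3` in front of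
`|𝔡^{≤s}∇₃A|²` (its relation to the table `normB` is `TransportWeightLedger.remark1122`).
[cite: GiorgiKlainermanSzeftel2024, Remark 11.2.2, p.484 L19–26; GiorgiKlainermanSzeftel2022, l.20544–20552] -/
def remNab3 (p : ℚ) : ℚ := p + 3

/-- Remark 11.2.2's display: the weight `p + 1` in front of `|𝔡^{≤s}A|²`.
[cite: GiorgiKlainermanSzeftel2024, Remark 11.2.2, p.484 L19–26; GiorgiKlainermanSzeftel2022, l.20544–20552] -/
def remZero (p : ℚ) : ℚ := p + 1

/-- Unfolding lemmas for `remNab3`, `remZero`. [cite: GiorgiKlainermanSzeftel2024, Remark 11.2.2, p.484 L19–26] -/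
@[simp] lemma rem_defs (p : ℚ) : remNab3 p = p + 3 ∧ remZero p = p + 1 := ⟨rfl, rfl⟩

/-- (6.1.15) and (6.1.21): the pairing weights of the `N`-norms — `0` for "`∫_M (|∇_R̂ψ| + r^{−1}|ψ|)|N|`", "`|∫_{M_trap} ∇_{T̂_δ}ψ · N|`",
"`∫_{M_notrap} |Dψ||N|`" and for the three quadratic summands "`∫_M |N|² + sup_τ ∫_{Σ(τ)} |N|² + ∫_{Σ_*} |N|²`"; and `p − 1` for the
added summand "`|∫_{M_{r≥4m}} r^{p−1} ∇₄(rψ) · N|`" of `N_p`.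
[cite: GiorgiKlainermanSzeftel2024, (6.1.15), p.219 L45–62, (6.1.21), p.220 L20–27; GiorgiKlainermanSzeftel2022, l.9929–9935, l.9975–9978] -/
def nExtPair (p : ℚ) : ℚ := p - 1

/-- Unfolding lemma for `nExtPair`. [cite: GiorgiKlainermanSzeftel2024, (6.1.21), p.220 L20–27] -/
@[simp] lemma nExtPair_def (p : ℚ) : nExtPair p = p - 1 := rfl

/-- The `r`-orders of the two structural inputs: (11.1.8) "`N₀ := (V − V₀)ψ = O(a r^{−4})ψ`" — order `−4`; (11.1.10) "Away from the
trapping, … `N_L = O(a)𝔡^{≤1}∇₃A + O(a r^{−1})𝔡^{≤1}A`" — orders `0` and `−1`.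
[cite: GiorgiKlainermanSzeftel2024, (11.1.8), p.478 L78–83, (11.1.10), p.478 L97–101; GiorgiKlainermanSzeftel2022, l.20310–20313, l.20327–20330] -/
def ordN0 : ℚ := -4

/-- Unfolding lemma for `ordN0`. [cite: GiorgiKlainermanSzeftel2024, (11.1.8), p.478 L78–83] -/
@[simp] lemma ordN0_def : ordN0 = -4 := rfl

/-- (6.1.16) is stated "For `0 < p < 2`"; Lemma 11.2.8's range `δ ≤ p ≤ 2 − δ` lies inside it for `0 < δ`, and so does the exponent
`max(q, δ)` of §11.5 for `−1 + δ ≤ q ≤ 1 − δ`.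
[cite: GiorgiKlainermanSzeftel2024, (6.1.16), p.219 L65, Lemma 11.2.8, p.485 L34, Theorem 11.2.4, p.484 L40–41; GiorgiKlainermanSzeftel2022, l.9938, l.20637, l.20582] -/
theorem ranges_in_domain (δ p q : ℚ) (hδ : 0 < δ) (hp : δ ≤ p ∧ p ≤ 2 - δ) (hq : -1 + δ ≤ q ∧ q ≤ 1 - δ) :
    (0 < p ∧ p < 2) ∧ (0 < max q δ ∧ max q δ < 2) ∧ (δ ≤ max q δ ∧ max q δ ≤ 1 - δ ∨ max q δ = δ) := by
  obtain ⟨hp1, hp2⟩ := hp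
  obtain ⟨hq1, hq2⟩ := hq
  refine ⟨⟨by linarith, by linarith⟩, ⟨lt_of_lt_of_le hδ (le_max_right _ _), ?_⟩, ?_⟩
  · rcases le_total q δ with h | h
    · rw [max_eq_right h]; linarith
    · rw [max_eq_left h]; linarith
  · rcases le_total q δ with h | h
    · exact Or.inr (max_eq_right h)
    · exact Or.inl ⟨le_max_right _ _, by rw [max_eq_left h]; exact hq2⟩

/-! ## §1 `[J]` §11.3.1 — proof of (11.3.1): the `(Mor)` and `(ext)` pairings with `N₀ + N_L` -/

/-- `(Mor)` pairing, `[J]` p.488 L1–120: "`(Mor)N^s[ψ, N₀+N_L] ≲ Σ_{k≤s} ∫_M (|∇_R̂𝔡^kψ| + r^{−1}|𝔡^kψ|)(|𝔡^kN₀| + |𝔡^kN_L|)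
≲ (∫ r^{−1−δ}(|∇_R̂𝔡^{≤s}ψ|² + r^{−2}|𝔡^{≤s}ψ|²))^{1/2} (∫ r^{1+δ}(|𝔡^{≤s}N₀|² + |𝔡^{≤s}N_L|²))^{1/2}`": the Cauchy–Schwarz weights
`−1−δ` and `1+δ` add to twice the pairing weight `0`, and for the `r^{−1}|ψ||N|` piece `(−3−δ) + (1+δ) = 2·(−1)`.
[cite: GiorgiKlainermanSzeftel2024, p.488 L1–62; GiorgiKlainermanSzeftel2022, l.20752–20757] -/
theorem mor_pairing (δ : ℚ) : (-1 - δ) + (1 + δ) = 2 * 0 ∧ (-1 - δ - 2) + (1 + δ) = 2 * (-1) := by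
  constructor <;> ring

/-- `(Mor)` pairing, `ψ`-side, `[J]` p.488 L30–62: "`∫ r^{−1−δ}(|∇_R̂𝔡^{≤s}ψ|² 1_{r≤4m} + (|∇₃ψ|² + r^{−2}|𝔡ψ|²) 1_{r≥4m} + r^{−2}|ψ|²)
≲ (B^s_δ[ψ])`".  On `r ≥ 4m`: `r^{−1−δ}|∇₃ψ|²` IS the slot `Morr` adds to `Mor` (slack `0`); `r^{−3−δ}|𝔡ψ|²` sits below `B_δ`'s
`r^{δ−3}|𝔡ψ|²` with slack `2δ`; `r^{−3−δ}|ψ|²` sits below `Mor`'s `r^{−3}|ψ|²` with slack `δ` (and below `B_δ`'s `r^{δ−3}|ψ|²` with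
slack `2δ`). [cite: GiorgiKlainermanSzeftel2024, p.488 L30–62, (6.1.12), (6.1.16); GiorgiKlainermanSzeftel2022, l.20754–20757, l.9902–9941] -/
theorem mor_psi_side (δ inner : ℚ) (hδ : 0 ≤ δ) :
    morrNab3 δ = -1 - δ ∧
    (-1 - δ - 2 + inner ≤ bPsiDk δ inner ∧ bPsiDk δ inner - (-1 - δ - 2 + inner) = 2 * δ) ∧
    (-1 - δ - 2 ≤ morZero ∧ morZero - (-1 - δ - 2) = δ) ∧ (-1 - δ - 2 ≤ bPsiZero δ ∧ bPsiZero δ - (-1 - δ - 2) = 2 * δ) := by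
  refine ⟨rfl, ?_, ?_, ?_⟩
  · simp only [bPsiDk_def]
    exact ⟨by linarith, by ring⟩
  · simp only [morZero]
    exact ⟨by linarith, by ring⟩
  · simp only [bPsiZero_def]
    exact ⟨by linarith, by ring⟩

/-- `(Mor)` pairing, `N₀`-side, `[J]` p.488 L124–127: "Since `N₀ = O(a r^{−4})ψ`, we have
`Σ_{k≤s} ∫ r^{1+δ}|𝔡^{≤s}N₀|² ≲ |a| Mor^s[ψ]`": the weight `(1+δ) + 2·(−4) = δ − 7` sits below `Mor`'s zeroth slot `−3` iff `δ ≤ 4`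
(slack `4 − δ`). [cite: GiorgiKlainermanSzeftel2024, p.488 L124–127; GiorgiKlainermanSzeftel2022, l.20760–20764] -/
theorem mor_N0_side (δ : ℚ) : (1 + δ) + 2 * ordN0 = δ - 7 ∧ (δ - 7 ≤ morZero ↔ δ ≤ 4) ∧ morZero - (δ - 7) = 4 - δ := by
  simp only [ordN0_def, morZero]
  refine ⟨by ring, ⟨fun h => by linarith, fun h => by linarith⟩, by ring⟩

/-- `(Mor)` pairing, `N_L`-side, `[J]` p.488 L131–151: by (11.1.10), "`Σ_{k≤s} ∫ r^{1+δ}|𝔡^kN_L|² ≲ a² ∫ r^{1+δ}(|∇₃𝔡^{≤s+1}A|² +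
r^{−2}|𝔡^{≤s+1}A|²) ≲ a² B^s_δ[A]`": squaring (11.1.10) gives the weights `1+δ+0` and `1+δ−2`; against Remark 11.2.2's display at
`p = δ` (one level up, `B^s_δ[A] ⊇ ∫ r^{δ+1}(r²|𝔡^{≤s+1}∇₃A|² + |𝔡^{≤s+1}A|²)`) both sit with slack EXACTLY `2`.
[cite: GiorgiKlainermanSzeftel2024, p.488 L131–151, Remark 11.2.2, p.484 L19–26; GiorgiKlainermanSzeftel2022, l.20766–20772, l.20544–20552] -/
theorem mor_NL_side (δ : ℚ) :
    (1 + δ + 2 * 0 ≤ remNab3 δ ∧ remNab3 δ - (1 + δ + 2 * 0) = 2) ∧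
    (1 + δ + 2 * (-1) ≤ remZero δ ∧ remZero δ - (1 + δ + 2 * (-1)) = 2) := by
  simp only [(rem_defs δ).1, (rem_defs δ).2]
  refine ⟨⟨by linarith, by ring⟩, ⟨by linarith, by ring⟩⟩

/-- `(ext)` pairing, `[J]` p.489 L2–70: "`(ext)N^s_p[ψ, N₀+N_L] = Σ_{k≤s} |∫_{(ext)M} r^{p−1} ∇₄(r𝔡^kψ) · (𝔡^kN₀ + 𝔡^kN_L)|
≲ (∫ r^{p−3}|𝔡^{≤s+1}ψ|²)^{1/2} (∫ r^{p+1}(|𝔡^{≤s}N₀|² + |𝔡^{≤s}N_L|²))^{1/2} ≲ (B^{ext,s}_p[ψ])^{1/2}(…)^{1/2}`": `∇₄(r f) = (r∇₄)f + O(1)f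
∈ 𝔡^{≤1}f` (inner offset of `r∇₄` is `2`, none spent here); the weights `p−3` and `p+1` add to `2(p−1)`; and `r^{p−3}|𝔡^{≤s+1}ψ|²` IS
`B^s_p[ψ]`'s far slot `r^{p−3}|𝔡(𝔡^{≤s}ψ)|²` read with inner offset `0` (slack `0`) — the zeroth-order reading `bPsiZero p`.
[cite: GiorgiKlainermanSzeftel2024, p.489 L2–70, (6.1.21), p.220 L20–27; GiorgiKlainermanSzeftel2022, l.20777–20786, l.9975–9978] -/
theorem ext_pairing (p : ℚ) : (p - 3) + (p + 1) = 2 * nExtPair p ∧ p - 3 = bPsiDk p 0 ∧ p - 3 = bPsiZero p := by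
  refine ⟨?_, ?_, rfl⟩
  · simp only [nExtPair_def]
    ring
  · simp only [bPsiDk_def]
    ring

/-- `(ext)` pairing, `N₀`-side, `[J]` p.489 L73–78 (with footnote 5 "Recall the definition of the `B_p[A]` norms and Remark 11.2.2"):
"for `δ ≤ p ≤ 2−δ`, `Σ ∫_{(ext)M} r^{p+1}|𝔡^kN₀|² ≲ |a| ∫_{(ext)M} r^{p−7}|𝔡^{≤s}ψ|² ≲ |a| B^s_δ[ψ]`": `(p+1) + 2·(−4) = p − 7`, and
`r^{p−7}` sits below `B_δ`'s far zeroth slot `r^{δ−3}` iff `p ≤ 4 + δ` — on the printed range with slack `4 + δ − p ≥ 2 + 2δ`.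
[cite: GiorgiKlainermanSzeftel2024, p.489 L73–78; GiorgiKlainermanSzeftel2022, l.20789–20791] -/
theorem ext_N0_side (δ p : ℚ) :
    (p + 1) + 2 * ordN0 = p - 7 ∧ (p - 7 ≤ bPsiZero δ ↔ p ≤ 4 + δ) ∧ (p ≤ 2 - δ → bPsiZero δ - (p - 7) ≥ 2 + 2 * δ) := by
  simp only [ordN0_def, bPsiZero_def]
  refine ⟨by ring, ⟨fun h => by linarith, fun h => by linarith⟩, fun h => by linarith⟩

/-- `(ext)` pairing, `N_L`-side, `[J]` p.489 L80–88: "`Σ ∫_{(ext)M} r^{p+1}|𝔡^kN_L|² ≲ |a| ∫_{(ext)M} r^{p+1}(|𝔡^{≤s+1}∇₃A|² +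
r^{−2}|𝔡^{≤s+1}A|²) ≲ |a| B^s_δ[A]`": against Remark 11.2.2's display at level `δ` the two weights `p+1`, `p−1` need `p + 1 ≤ δ + 3`
and `p − 1 ≤ δ + 1`, i.e. BOTH exactly `p ≤ 2 + δ`; on the printed range `p ≤ 2 − δ` they hold with slack `2 + δ − p ≥ 2δ`.  So the
upper end `2 − δ` of Lemma 11.2.8's range is, up to `2δ`, where this domination stops [our reading of where the range comes from; (6.1.16)'s
"`0 < p < 2`" is the other source]. [cite: GiorgiKlainermanSzeftel2024, p.489 L80–106, Lemma 11.2.8, p.485 L34; GiorgiKlainermanSzeftel2022, l.20792–20803] -/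
theorem ext_NL_side (δ p : ℚ) :
    ((p + 1 ≤ remNab3 δ ↔ p ≤ 2 + δ) ∧ (p - 1 ≤ remZero δ ↔ p ≤ 2 + δ)) ∧
    (p ≤ 2 - δ → remNab3 δ - (p + 1) ≥ 2 * δ ∧ remZero δ - (p - 1) ≥ 2 * δ) ∧
    (0 < δ → 2 - δ < 2 + δ) := by
  simp only [(rem_defs δ).1, (rem_defs δ).2]
  refine ⟨⟨⟨fun h => by linarith, fun h => by linarith⟩, ⟨fun h => by linarith, fun h => by linarith⟩⟩,
    fun h => ⟨by linarith, by linarith⟩, fun h => by linarith⟩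

/-- (R3) The quadratic bulk summand `∫_M |𝔡^{≤s}N|²` of (6.1.15) (pairing weight `0`), not named in §11.3's list: its `N₀`-part has weight
`0 + 2·(−4) = −8 ≤ −3` (`Mor`'s zeroth slot, slack `5`), its `N_L`-part has weights `0` and `−2`, below Remark 11.2.2's `δ + 3` and
`δ + 1` for every `δ ≥ 0` (slack `3 + δ`); the pairing `∫_{M_notrap} |D𝔡^{≤s}ψ||𝔡^{≤s}N|` has the `(Mor)` weights of `mor_pairing`
[our reading; the text treats these summands tacitly]. [cite: GiorgiKlainermanSzeftel2024, (6.1.15), p.219 L45–62, p.486 L40–47; GiorgiKlainermanSzeftel2022, l.9929–9935, l.20696–20702] -/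
theorem bulk_quadratic_summands (δ : ℚ) (hδ : 0 ≤ δ) :
    (0 + 2 * ordN0 ≤ morZero ∧ morZero - (0 + 2 * ordN0) = 5) ∧ (0 ≤ remNab3 δ ∧ remNab3 δ - 0 = 3 + δ) ∧
    (-2 ≤ remZero δ ∧ remZero δ - (-2) = 3 + δ) := by
  simp only [ordN0_def, morZero, (rem_defs δ).1, (rem_defs δ).2]
  refine ⟨⟨by norm_num, by norm_num⟩, ⟨by linarith, by ring⟩, ⟨by linarith, by ring⟩⟩

/-- (R3) The `Σ`-summands `sup_τ ∫_{Σ(τ)} |𝔡^{≤s}N_L|²` and `∫_{Σ_*} |𝔡^{≤s}N_L|²` of (6.1.15): by (11.1.10) they involve, at level `s`,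
the `Σ`-integrals of `𝔡^{≤1}∇₃^{≤1}(𝔡^{≤s}A)`, i.e. the slots `0,…,6`.  Of these, `E_p[A]` / `F_p[A]` (table `normE`) carry `0, 1, 2` (and
`5` only cut off, as slot `8`), and (11.2.7) — stated on `Σ(τ)` — carries `3, 5, 6` (table `norm1127rest`) and `4`; §11.3.3's footnotes
7–8 (p.492 L130–133, p.494 L59–62) "for the boundary terms, we use the control of `A` provided by `E_δ[A]` as well as the one provided by (11.2.7)".  Recorded: the slots
of `A` not in `normE` are exactly `{3, 4, 5, 6}`, all of which but `4` are in `norm1127rest`; all offsets involved are `≥ 2 > 0 =` the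
summand's weight. [our reading] [cite: GiorgiKlainermanSzeftel2024, (6.1.15), p.219 L45–62, p.492 L130–133, p.494 L59–62, (11.2.7), p.486 L11–21; GiorgiKlainermanSzeftel2022, l.9929–9935, l.20895, l.20969, l.20660–20665] -/
theorem sigma_summand_slots :
    (({0, 1, 2, 3, 4, 5, 6} : Finset ℕ) \ normE.image Prod.fst = {3, 4, 5, 6}) ∧
    (({3, 5, 6} : Finset ℕ) ⊆ norm1127rest.image Prod.fst) ∧ (4 ∉ norm1127rest.image Prod.fst) ∧
    (∀ x ∈ normE, 2 ≤ x.2) ∧ (∀ x ∈ norm1127rest, 4 ≤ x.2) := by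
  decide

/-! ## §2 `N₀ = (V − V₀)ψ` carries the factor `a²` exactly (Kerr values of `GRWTransformationAlgebra`) -/

section Potential

variable {K : Type*} [Field K] [CharZero K]

/-- The numerator polynomial of `V − V₀`: `(2 − cos²θ)r⁶ − (2 + 6cos²θ)m r⁵ + (2 + 3cos²θ − cos⁴θ)a²r⁴ − 10 m cos²θ a²r³
+ (4cos²θ + cos⁴θ)a⁴r² − 2 m cos⁴θ a⁴ r + 2cos⁴θ a⁶` (`c = cos θ`). [folklore] -/
def numN0 (r a m c : K) : K :=
  (2 - c ^ 2) * r ^ 6 - (2 + 6 * c ^ 2) * m * r ^ 5 + (2 + 3 * c ^ 2 - c ^ 4) * a ^ 2 * r ^ 4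
    - 10 * m * c ^ 2 * a ^ 2 * r ^ 3 + (4 * c ^ 2 + c ^ 4) * a ^ 4 * r ^ 2 - 2 * m * c ^ 4 * a ^ 4 * r + 2 * c ^ 4 * a ^ 6

/-- (11.1.8) "`N₀ := (V − V₀)ψ = O(a r^{−4})ψ`" with `V` the potential of Theorem 5.2.9 (`GRWTransformationAlgebra.Vpot`) and
`V₀ = 4Δ/((r²+a²)|q|²)` of (11.1.6) (`GRWTransformationAlgebra.V0v1`; in Chapter 11 this `V₀` is printed in BOTH texts): in Kerr,
`V − V₀ = 4a² · numN0 / (r²(r²+a²)|q|⁶)` — the factor `a²` is exact, in agreement with §11.5 Step 2a "since `N₀ = O(a²r^{−4})ψ`" (R1).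
[cite: GiorgiKlainermanSzeftel2024, (11.1.6), p.478 L55–60, (11.1.8), p.478 L78–83, p.523 L79; GiorgiKlainermanSzeftel2022, l.20300, l.20310–20313, l.22187] -/
theorem V_sub_V0 (r a m c : K) (hr : r ≠ 0) (hN : nsq r a c ≠ 0) (hra : r ^ 2 + a ^ 2 ≠ 0) :
    Vpot r a m c - V0v1 r a m c = 4 * a ^ 2 * numN0 r a m c / (r ^ 2 * (r ^ 2 + a ^ 2) * nsq r a c ^ 3) := by
  have h1 := Vpot_sub r a m c hr hN
  have h2 := V0v1_sub r a m c hN hra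
  have key : Vpot r a m c - V0v1 r a m c
      = 4 * a ^ 2 * (r ^ 4 * (1 + c ^ 2) - 10 * m * c ^ 2 * r ^ 3 + 4 * a ^ 2 * c ^ 2 * r ^ 2
          - 2 * m * a ^ 2 * c ^ 4 * r + 2 * a ^ 4 * c ^ 4) / (r ^ 2 * nsq r a c ^ 3)
        - 4 * a ^ 2 * Del r a m * (r ^ 2 * (2 * c ^ 2 - 1) + a ^ 2 * c ^ 4) / ((r ^ 2 + a ^ 2) * nsq r a c ^ 3) := by
    linear_combination h1 - h2
  rw [key]
  unfold numN0 Del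
  unfold nsq at *
  field_simp
  ring

/-- At `a = 0` the two potentials agree (Schwarzschild): `N₀ = 0`.  Uses `Vpot_a_zero`, `V0v1_a_zero` of `GRWTransformationAlgebra`.
[cite: GiorgiKlainermanSzeftel2024, Remark 5.2.11, p.194 L20–27, (11.1.8), p.478 L78–83; GiorgiKlainermanSzeftel2022, l.8867, l.8907, l.20312] -/
theorem V_sub_V0_a_zero (r m c : K) (hr : r ≠ 0) : Vpot r 0 m c - V0v1 r 0 m c = 0 := by
  rw [Vpot_a_zero r m c hr, V0v1_a_zero r m c hr, sub_self]

/-- The leading (`r⁶`) coefficient `2 − cos²θ` of `numN0` lies in `[1, 2]`, so for `r → ∞` `V − V₀ ∼ 4a²(2 − cos²θ)r^{−4}`: the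
order `a²r^{−4}` of `N₀/ψ` is attained, not merely an upper bound (over `ℝ`, `c² ≤ 1`). [folklore] -/
theorem numN0_leading (c : ℝ) (hc : c ^ 2 ≤ 1) (hc0 : 0 ≤ c ^ 2) : 1 ≤ 2 - c ^ 2 ∧ 2 - c ^ 2 ≤ 2 := by
  constructor <;> linarith

omit [CharZero K] in
/-- The squared size entering §11.5 Step 2a: "`a⁴ ∫ r^{q+5}|r^{−4}𝔡^{≤s+1}ψ|²`" — `(a²)² = a⁴` and `(r^{−4})²` contributes `2·(−4)`.
[cite: GiorgiKlainermanSzeftel2024, p.523 L79–99; GiorgiKlainermanSzeftel2022, l.22187–22193] -/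
theorem N0_squared_orders (a : K) : (a ^ 2) ^ 2 = a ^ 4 ∧ (2 : ℚ) * ordN0 = -8 := by
  refine ⟨by ring, by simp only [ordN0_def]; norm_num⟩

end Potential

/-! ## §3 The vector fields `T, Z` (Definition 6.1.10), `T̂, R̂` ((6.1.9)), `T̂_δ` (Definition 6.1.13) as coefficient triples -/

section VectorFields

variable {K : Type*} [Field K] [CharZero K]

/-- Coefficient triples on `(e₄, e₃, ℜ(𝔍)^b e_b)`; `c = cos θ`, `sin²θ = 1 − c²`, `|q|² = r² + a²c²` (`nsq`), `Δ = r² − 2mr + a²` (`Del`).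
Definition 6.1.10: "`T := ½(e₄ + (Δ/|q|²)e₃ − 2aℜ(𝔍)^b e_b)`".
[cite: GiorgiKlainermanSzeftel2024, Definition 6.1.10, p.217 L5–14; GiorgiKlainermanSzeftel2022, l.9820–9824] -/
def vT (r a m c : K) : Fin 3 → K := ![1 / 2, Del r a m / (2 * nsq r a c), -a]

/-- Definition 6.1.10: "`Z := ½(2(r²+a²)ℜ(𝔍)^b e_b − a(sin θ)²e₄ − (a(sin θ)²Δ/|q|²)e₃)`".
[cite: GiorgiKlainermanSzeftel2024, Definition 6.1.10, p.217 L17–27; GiorgiKlainermanSzeftel2022, l.9825–9828] -/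
def vZ (r a m c : K) : Fin 3 → K :=
  ![-(a * (1 - c ^ 2)) / 2, -(a * (1 - c ^ 2) * Del r a m) / (2 * nsq r a c), r ^ 2 + a ^ 2]

/-- (6.1.9): "`T̂ = ½((|q|²/(r²+a²))e₄ + (Δ/(r²+a²))e₃)`". [cite: GiorgiKlainermanSzeftel2024, (6.1.9), p.218 L5–17; GiorgiKlainermanSzeftel2022, l.9862–9864] -/
def vThat (r a m c : K) : Fin 3 → K := ![nsq r a c / (2 * (r ^ 2 + a ^ 2)), Del r a m / (2 * (r ^ 2 + a ^ 2)), 0]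

/-- (6.1.9): "`R̂ = ½((|q|²/(r²+a²))e₄ − (Δ/(r²+a²))e₃)`". [cite: GiorgiKlainermanSzeftel2024, (6.1.9), p.218 L19–30; GiorgiKlainermanSzeftel2022, l.9862–9864] -/
def vRhat (r a m c : K) : Fin 3 → K := ![nsq r a c / (2 * (r ^ 2 + a ^ 2)), -(Del r a m / (2 * (r ^ 2 + a ^ 2))), 0]

/-- Definition 6.1.13: "`T̂_δ := T + (a/(r²+a²)) χ₀(δ^{−1}𝒯/r³) Z` with `δ = δ_trap` and `χ₀(x) = 0` if `|x| ≤ 1`, `= 1` if `|x| ≥ 2`",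
"(6.1.11) `T̂_δ := T + χ_δ Z`"; here `x` stands for the value of `χ₀`.
[cite: GiorgiKlainermanSzeftel2024, Definition 6.1.13, p.218 L32–57; GiorgiKlainermanSzeftel2022, l.9874–9890] -/
def vThatδ (x r a m c : K) : Fin 3 → K := vT r a m c + (a / (r ^ 2 + a ^ 2) * x) • vZ r a m c

/-- The frame vectors `e₄`, `e₃` themselves as triples. [folklore] -/
def vE4 : Fin 3 → K := ![1, 0, 0]

/-- The frame vector `e₃` as a triple. [folklore] -/
def vE3 : Fin 3 → K := ![0, 1, 0]

/-- §11.3.3, `[J]` p.492 L75–87: "we have `T = T̂ − (a/(r²+a²))Z`" — an identity of Definition 6.1.10 and (6.1.9) in Kerr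
(`|q|² + a²sin²θ = r² + a²` does the work on the `e₄`- and `e₃`-components).
[cite: GiorgiKlainermanSzeftel2024, p.492 L75–87; GiorgiKlainermanSzeftel2022, l.20914–20918] -/
theorem T_eq_That_sub_Z (r a m c : K) (hra : r ^ 2 + a ^ 2 ≠ 0) (hN : nsq r a c ≠ 0) :
    vT r a m c = vThat r a m c - (a / (r ^ 2 + a ^ 2)) • vZ r a m c := by
  funext i
  fin_cases i
  · show (1 : K) / 2 = nsq r a c / (2 * (r ^ 2 + a ^ 2)) - a / (r ^ 2 + a ^ 2) * (-(a * (1 - c ^ 2)) / 2)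
    unfold nsq at *
    field_simp
    ring
  · show Del r a m / (2 * nsq r a c)
        = Del r a m / (2 * (r ^ 2 + a ^ 2)) - a / (r ^ 2 + a ^ 2) * (-(a * (1 - c ^ 2) * Del r a m) / (2 * nsq r a c))
    unfold nsq at *
    field_simp
    ring
  · show -a = 0 - a / (r ^ 2 + a ^ 2) * (r ^ 2 + a ^ 2)
    field_simp
    ring

/-- (6.1.9): `T̂ = R̂ + (Δ/(r²+a²)) e₃`. [cite: GiorgiKlainermanSzeftel2024, (6.1.9), p.218 L5–30, p.492 L80–87; GiorgiKlainermanSzeftel2022, l.9862–9864, l.20917–20918] -/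
theorem That_eq_Rhat_add_e3 (r a m c : K) (hra : r ^ 2 + a ^ 2 ≠ 0) :
    vThat r a m c = vRhat r a m c + (Del r a m / (r ^ 2 + a ^ 2)) • vE3 := by
  funext i
  fin_cases i
  · show nsq r a c / (2 * (r ^ 2 + a ^ 2)) = nsq r a c / (2 * (r ^ 2 + a ^ 2)) + Del r a m / (r ^ 2 + a ^ 2) * 0
    ring
  · show Del r a m / (2 * (r ^ 2 + a ^ 2)) = -(Del r a m / (2 * (r ^ 2 + a ^ 2))) + Del r a m / (r ^ 2 + a ^ 2) * 1
    field_simp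
    ring
  · show (0 : K) = 0 + Del r a m / (r ^ 2 + a ^ 2) * 0
    ring

/-- §11.3.3, `[J]` p.492 L57–110 in full: "`T = T̂ − (a/(r²+a²))Z = R̂ + (Δ/(r²+a²))e₃ − (a/(r²+a²))Z`, and hence
`a∇_T∇_Z∇₃A = a∇_R̂∇_Z∇₃A + (aΔ/(r²+a²))∇₃∇_Z∇₃A − (a²/(r²+a²))∇²_Z∇₃A`" — the coefficient identity behind it, with the printed
prefactors `a`, `aΔ/(r²+a²)`, `−a²/(r²+a²)`.
[cite: GiorgiKlainermanSzeftel2024, p.492 L57–110; GiorgiKlainermanSzeftel2022, l.20906–20925] -/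
theorem en_expansion (r a m c : K) (hra : r ^ 2 + a ^ 2 ≠ 0) (hN : nsq r a c ≠ 0) :
    a • vT r a m c
      = a • vRhat r a m c + (a * Del r a m / (r ^ 2 + a ^ 2)) • vE3 + (-(a ^ 2 / (r ^ 2 + a ^ 2))) • vZ r a m c := by
  rw [T_eq_That_sub_Z r a m c hra hN, That_eq_Rhat_add_e3 r a m c hra, smul_sub, smul_add, smul_smul, smul_smul]
  have h1 : a * (Del r a m / (r ^ 2 + a ^ 2)) = a * Del r a m / (r ^ 2 + a ^ 2) := by ring
  have h2 : -(a ^ 2 / (r ^ 2 + a ^ 2)) = -(a * (a / (r ^ 2 + a ^ 2))) := by ring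
  rw [h1, h2, neg_smul, sub_eq_add_neg]

/-- Definition 6.1.13 / §11.3.2–§11.3.3: "where `χ₀(δ^{−1}𝒯/r³) = 0` on `M_trap`" — there `T̂_δ = T`; and where `χ₀ = 1` (away from
trapping) `T̂_δ = T + (a/(r²+a²))Z = T̂`, the vector field of (6.1.9) [the second clause is our remark].
[cite: GiorgiKlainermanSzeftel2024, Definition 6.1.13, p.218 L32–57, p.491 L2–16; GiorgiKlainermanSzeftel2022, l.9874–9890, l.20857–20861] -/
theorem Thatδ_regimes (r a m c : K) (hra : r ^ 2 + a ^ 2 ≠ 0) (hN : nsq r a c ≠ 0) :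
    vThatδ 0 r a m c = vT r a m c ∧ vThatδ 1 r a m c = vThat r a m c := by
  constructor
  · simp [vThatδ]
  · rw [vThatδ, mul_one, T_eq_That_sub_Z r a m c hra hN, sub_add_cancel]

/-- Inverting (6.1.9): `e₄ = ((r²+a²)/|q|²)(T̂ + R̂)` and `e₃ = ((r²+a²)/Δ)(T̂ − R̂)` (away from `Δ = 0`); used whenever `∇₄`, `∇₃` are
traded for `∇_T̂`, `∇_R̂`. [folklore] -/
theorem e4_e3_of_That_Rhat (r a m c : K) (hra : r ^ 2 + a ^ 2 ≠ 0) (hN : nsq r a c ≠ 0) (hD : Del r a m ≠ 0) :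
    ((r ^ 2 + a ^ 2) / nsq r a c) • (vThat r a m c + vRhat r a m c) = vE4 ∧
    ((r ^ 2 + a ^ 2) / Del r a m) • (vThat r a m c - vRhat r a m c) = vE3 := by
  constructor
  · funext i
    fin_cases i
    · show (r ^ 2 + a ^ 2) / nsq r a c * (nsq r a c / (2 * (r ^ 2 + a ^ 2)) + nsq r a c / (2 * (r ^ 2 + a ^ 2))) = 1
      field_simp
      ring
    · show (r ^ 2 + a ^ 2) / nsq r a c * (Del r a m / (2 * (r ^ 2 + a ^ 2)) + -(Del r a m / (2 * (r ^ 2 + a ^ 2)))) = 0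
      ring
    · show (r ^ 2 + a ^ 2) / nsq r a c * (0 + 0) = (0 : K)
      ring
  · funext i
    fin_cases i
    · show (r ^ 2 + a ^ 2) / Del r a m * (nsq r a c / (2 * (r ^ 2 + a ^ 2)) - nsq r a c / (2 * (r ^ 2 + a ^ 2))) = 0
      ring
    · show (r ^ 2 + a ^ 2) / Del r a m * (Del r a m / (2 * (r ^ 2 + a ^ 2)) - -(Del r a m / (2 * (r ^ 2 + a ^ 2)))) = 1
      field_simp
      ring
    · show (r ^ 2 + a ^ 2) / Del r a m * (0 - 0) = (0 : K)
      ring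

end VectorFields

/-- Size of the coefficients of `T̂`, `R̂` in (6.1.9), over `ℝ` with `c² ≤ 1`, `0 ≤ m ≤ r`: `0 < |q|² ≤ r² + a²` and `|Δ| ≤ r² + a²`, so
both coefficients are at most `½` in absolute value; this is what "`|∇_R̂ f|² ≲ |∇₃f|² + r^{−2}|𝔡f|²`" (the `ψ`-side of the `(Mor)`
pairing on `r ≥ 4m`, `[J]` p.488 L30–45) costs. [folklore] -/
theorem That_Rhat_coeff_bounds (r a m c : ℝ) (hr : 0 < r) (hm : 0 ≤ m) (hmr : m ≤ r) (hc : c ^ 2 ≤ 1) :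
    0 < nsq r a c ∧ nsq r a c ≤ r ^ 2 + a ^ 2 ∧ |Del r a m| ≤ r ^ 2 + a ^ 2 := by
  have ha : 0 ≤ a ^ 2 := sq_nonneg a
  have hc0 : 0 ≤ c ^ 2 := sq_nonneg c
  have hac : a ^ 2 * c ^ 2 ≤ a ^ 2 := by nlinarith
  refine ⟨?_, ?_, ?_⟩
  · unfold nsq; nlinarith
  · unfold nsq; linarith
  · unfold Del
    rw [abs_le]
    constructor <;> nlinarith

/-! ## §4 `[J]` §11.5 — proof of Theorem 11.2.4: Steps 1–3 -/

/-- (11.5.1) / Theorem 6.2.2: the error term "`Ñ^s_q[ψ̌, N] = Σ_{k≤s} ∫_{M_{≥R}} r^{q+2}|𝔡^kψ̌|(|∇₄𝔡^kN| + r^{−1}|𝔡^kN|)`" and Step 2's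
rewriting "`|∫_{(ext)M} r^{q+1}∇̌₄𝔡^{≤s}ψ̌ · 𝔡^{≤s+1}N|`": `r^{q+2}∇₄ = r^{q+1}(r∇₄)` with `r∇₄ ∈ 𝔡`, and `r^{q+2}·r^{−1} = r^{q+1}` (R2).
[cite: GiorgiKlainermanSzeftel2024, (11.5.1), p.522 L5–45, p.522 L78–133, Theorem 6.2.2, p.221 L1–20; GiorgiKlainermanSzeftel2022, l.22147–22152, l.22165–22178, l.10050–10056] -/
theorem step2_rewrite (q : ℚ) : q + 2 - 1 = q + 1 ∧ q + 2 + (-1) = q + 1 := by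
  constructor <;> ring

/-- §11.5 Step 2a, `[J]` p.523 L9–99: "`|∫ r^{q+1}∇̌₄𝔡^{≤s}ψ̌ · 𝔡^{≤s+1}N₀| ≲ (∫ r^{q−3}|∇̌₄𝔡^{≤s}ψ̌|²)^{1/2}(∫ r^{q+5}|𝔡^{≤s+1}N₀|²)^{1/2}
≲ (B^s_q[ψ̌])^{1/2}(…)^{1/2}`" and "since `N₀ = O(a²r^{−4})ψ`, `∫ r^{q+5}|𝔡^{≤s+1}N₀|² ≲ a⁴ ∫ r^{q+5}|r^{−4}𝔡^{≤s+1}ψ|² ≲ a⁴ ∫ r^{q−3}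
|𝔡^{≤s+1}ψ|² ≲ a⁴ B^{s+1}_{max(q,δ)}[ψ]`": the weights `q−3`, `q+5` add to `2(q+1)`; `r^{q−3}|∇̌₄𝔡^{≤s}ψ̌|²` sits in `B_q[𝔡^{≤s}ψ̌]`'s
far slot read with inner offset `0` (slack `0`; the inner offset `2` of `r∇₄` is not spent); `(q+5) + 2·(−4) = q − 3` EXACTLY the far
zeroth slot of `B_q`, and `q − 3 ≤ max(q,δ) − 3`.
[cite: GiorgiKlainermanSzeftel2024, p.523 L9–123; GiorgiKlainermanSzeftel2022, l.22182–22196] -/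
theorem step2a (q δ : ℚ) :
    (q - 3) + (q + 5) = 2 * (q + 1) ∧ q - 3 = bPsiDk q 0 ∧ bPsiDk q 2 - (q - 3) = 2 ∧
    (q + 5) + 2 * ordN0 = bPsiZero q ∧ bPsiZero q ≤ bPsiZero (max q δ) := by
  simp only [bPsiDk_def, ordN0_def, bPsiZero_def]
  refine ⟨by ring, by ring, by ring, by ring, by linarith [le_max_left q δ]⟩

/-- §11.5 Step 2b, `[J]` p.523 L125–204: by (11.1.10), "`|∫ r^{q+1}∇̌₄𝔡^{≤s}ψ̌ · 𝔡^{≤s+1}N_L| ≲ |a| ∫ r^{q+1}|∇̌₄𝔡^{≤s}ψ̌|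
(|𝔡^{≤s+2}∇₃A| + r^{−1}|𝔡^{≤s+2}A|) ≲ |a|(∫ r^{q−1}|∇̌₄𝔡^{≤s}ψ̌|²)^{1/2}(∫ r^{q+3}|𝔡^{≤s+2}∇₃A|²)^{1/2} + |a|(∫ r^{q−1}|∇̌₄𝔡^{≤s}ψ̌|²)^{1/2}
(∫ r^{q+1}|𝔡^{≤s+2}A|²)^{1/2} ≲ |a|(B^s_q[ψ̌])^{1/2}(∫ r^{q+1}(r²|𝔡^{≤s+2}∇₃A|² + |𝔡^{≤s+2}A|²))^{1/2} ≲ |a| B^{s+1}_{max(q,δ)}[ψ, A]`":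
`(q−1) + (q+3) = 2(q+1)` and `(q−1) + (q+1) = 2q` (the second pairing has weight `q + 1 − 1`); `r^{q−1}|∇̌₄·|²` is EXACTLY `B_q`'s far
`∇₄`-slot `q − 3 + 2`; the `A`-side is Remark 11.2.2's display at `p = q` verbatim (`q + 3 = remNab3 q`, `q + 1 = remZero q`), one level
up, and `q ≤ max(q, δ)`. [cite: GiorgiKlainermanSzeftel2024, p.523 L125–204, Remark 11.2.2, p.484 L19–26; GiorgiKlainermanSzeftel2022, l.22198–22212, l.20544–20552] -/
theorem step2b (q δ : ℚ) :
    (q - 1) + (q + 3) = 2 * (q + 1) ∧ (q - 1) + (q + 1) = 2 * (q + 1 + (-1)) ∧ q - 1 = bPsiDk q 2 ∧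
    q + 3 = remNab3 q ∧ q + 1 = remZero q ∧ q ≤ max q δ := by
  refine ⟨by ring, by ring, ?_, rfl, rfl, le_max_left q δ⟩
  simp only [bPsiDk_def]
  ring

/-- §11.5 Steps 1 and 3, `[J]` p.522 L54–74 and p.523 L206–p.524 L44: Step 1 uses (11.3.2), (11.3.3) (level `s+1`) and bounds
`BEF^{s+1}_δ` by `BEF^{s+1}_{max(q,δ)}` — monotonicity in the exponent, `δ ≤ max(q,δ)`, every slot weight being `p +` a fixed offset;
Step 3 invokes Theorem 11.2.3 at `p = max(q, δ)`, which for `−1 + δ ≤ q ≤ 1 − δ` and `δ ≤ 1` lies in its range `δ ≤ p ≤ 2 − δ`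
(indeed `≤ 1 − δ` unless `p = δ`). [cite: GiorgiKlainermanSzeftel2024, p.522 L54–74, p.523 L206–226, p.524 L5–44, Theorem 11.2.3, p.484 L34; GiorgiKlainermanSzeftel2022, l.22158–22163, l.22216–22238, l.20568] -/
theorem steps_1_3 (q δ k : ℚ) (hδ1 : δ ≤ 1) (hq : -1 + δ ≤ q ∧ q ≤ 1 - δ) :
    (δ ≤ max q δ ∧ δ + k ≤ max q δ + k) ∧ (δ ≤ max q δ ∧ max q δ ≤ 2 - δ) ∧ max q δ ≤ max (1 - δ) δ := by
  obtain ⟨hq1, hq2⟩ := hq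
  have h1 : δ ≤ max q δ := le_max_right q δ
  have h2 : max q δ ≤ max (1 - δ) δ := max_le_max hq2 le_rfl
  have h3 : max (1 - δ) δ ≤ 2 - δ := max_le (by linarith) (by linarith)
  exact ⟨⟨h1, by linarith⟩, ⟨h1, le_trans h2 h3⟩, h2⟩

/-! ## §5 Theorem 11.2.3, Step 3: "as well as the smallness of `|a|/m`" — the absorption, as real-number arithmetic -/

/-- `[J]` p.486 L28–31: "As a consequence of Proposition 11.2.9 and Proposition 11.2.7, as well as the smallness of `|a|/m`, we deduce,
for all `s ≤ k_L` and for all `δ ≤ p ≤ 2 − δ`, `BEF^s_p[ψ, A] ≲ E^s_p[ψ, A](τ₁) + N^s_p[ψ, N_err] + ε₀²τ₁^{−2−3δ_dec}` as stated."  The shape: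
with `X = BEF^s_p[ψ]`, `Z = BEF^s_p[A]`, (11.2.4) `X ≤ K₁(E₁ + |a|·Y + N + e)` where `Y = BEF^s_δ[ψ, A] ≤ X + Z` (monotonicity, `δ ≤ p`),
(11.2.6) `Z ≤ K₂(X_B + E₂ + e)` where `X_B = B^s_p[ψ] ≤ X`; if `(1 + K₂)K₁|a| ≤ ½` the `|a|`-term is absorbed with a factor `2`.  The
constants `K₁, K₂` are the implicit constants of (11.2.4), (11.2.6) and are not quantified in the text; the cell's `|a|`-census lists
this locus. [cite: GiorgiKlainermanSzeftel2024, p.486 L28–31, (11.2.4), p.485 L25–30, (11.2.6), p.486 L5–9; GiorgiKlainermanSzeftel2022, l.20670–20675, l.20621–20628, l.20651–20657] -/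
theorem step3_absorption (X Z Y XB E1 E2 N e a K1 K2 : ℝ) (hK1 : 0 ≤ K1) (hK2 : 0 ≤ K2) (ha : 0 ≤ a) (hX : 0 ≤ X) (hZ : 0 ≤ Z)
    (h24 : X ≤ K1 * (E1 + a * Y + N + e)) (h26 : Z ≤ K2 * (XB + E2 + e)) (hXB : XB ≤ X) (hY : Y ≤ X + Z)
    (hsmall : (1 + K2) * K1 * a ≤ 1 / 2) :
    X + Z ≤ 2 * ((1 + K2) * K1 * (E1 + N + e) + K2 * (E2 + e)) := by
  have hZ' : Z ≤ K2 * X + K2 * (E2 + e) := by nlinarith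
  have haY : a * Y ≤ a * (X + Z) := mul_le_mul_of_nonneg_left hY ha
  have hX' : X ≤ K1 * (E1 + N + e) + K1 * a * (X + Z) := by nlinarith
  have hS : X + Z ≤ (1 + K2) * K1 * (E1 + N + e) + K2 * (E2 + e) + (1 + K2) * K1 * a * (X + Z) := by nlinarith
  have hXZ : 0 ≤ X + Z := by linarith
  have hab : (1 + K2) * K1 * a * (X + Z) ≤ 1 / 2 * (X + Z) := mul_le_mul_of_nonneg_right hsmall hXZ
  linarith

/-- The threshold form of "smallness of `|a|/m`" used above: `|a| ≤ 1/(2C)` with `C = (1 + K₂)K₁ > 0` gives `C|a| ≤ ½`. [folklore] -/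
theorem step3_threshold (C a : ℝ) (hC : 0 < C) (ha : |a| ≤ 1 / (2 * C)) : C * |a| ≤ 1 / 2 := by
  have h := mul_le_mul_of_nonneg_left ha (le_of_lt hC)
  calc C * |a| ≤ C * (1 / (2 * C)) := h
    _ = 1 / 2 := by field_simp

/-! ## §6 Arithmetic behind the junction and print data of this part of Chapter 11 -/

/-- Range junction (Q).  Theorem 11.2.4 is stated for the CLOSED range `−1 + δ ≤ q ≤ 1 − δ` (`[J]` p.484 L41, `[v1]` l.20582), and so are
Theorem 11.6.2 (`−1 + δ ≤ q ≤ 3δ_dec`, `[J]` p.524 L58–59, `[v1]` l.22262) and §11.7.3 Step 2 (`[J]` p.530 L28, L42, `[v1]` l.22407, l.22418),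
while the source Theorem 6.2.2, invoked in (11.5.1), is stated for the OPEN range `−1 + δ < q ≤ 1 − δ` (`[J]` p.221 L19–20, `[v1]`
l.10041): the endpoint `q = −1 + δ` is in the first and not in the second.  The quantitative uses downstream are the mean value argument "in
the range `−1 + 3δ_dec ≤ q ≤ 3δ_dec`" (`[J]` p.530 L48–49, `[v1]` l.22422) and `q = −δ` (Step 3, `[v1]` l.22430), which lie in the open range
as soon as `δ < 3δ_dec` and `δ < ½` — e.g. under the printed choice "`2δ ≤ δ_dec`" of Proposition 12.4.6, Step 7 (`DecayRateLedger`)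
[our reading; a statement-precision datum at the junction of Chapters 6 and 11, not a gap claim].
[cite: GiorgiKlainermanSzeftel2024, Theorem 11.2.4, p.484 L40–41, Theorem 6.2.2, p.221 L19–20, Theorem 11.6.2, p.524 L58–59, p.530 L28–49; GiorgiKlainermanSzeftel2022, l.20582, l.10041, l.22262, l.22407, l.22418, l.22422, l.22430] -/
theorem q_endpoint (δ δdec : ℚ) (hδ : 0 < δ) (h2 : 2 * δ ≤ δdec) (hhalf : δ < 1 / 2) :
    ((-1 + δ ≤ -1 + δ) ∧ ¬ (-1 + δ < -1 + δ)) ∧ (-1 + δ < -1 + 3 * δdec ∧ -1 + δ < -δ) ∧ (δ < 3 * δdec) := by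
  refine ⟨⟨le_rfl, lt_irrefl _⟩, ⟨by linarith, by linarith⟩, by linarith⟩

section CoefficientC1

variable {K : Type*} [Field K]

/-- Print datum (O), kernel side.  §11.3.3 expands "`ψ = ℜ(q q̄³(∇̌₃∇̌₃A + C₁∇̌₃A + C₂A)) = ℜ(q q̄³∇₃∇₃A) + O(a)𝔡^{≤1}A`" in `[v1]`
(l.20868–20878; kept with "`O(a)`" at l.20895 "`ψ₀ = ψ + O(a)𝔡^{≤1}A`" and in `[J]` at p.492 L8, p.493 L66, while `[J]` p.491 L35, L41 print
"`+ 𝔡^{≤1}A`" without `O(a)`).  With `C₁ = 2tr χ̲ − 2(⁽ᵃ⁾tr χ̲)²/tr χ̲ − 4i ⁽ᵃ⁾tr χ̲` ((11.1.4), `GRWTransformationAlgebra.C1`): at `a = 0`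
one has `⁽ᵃ⁾tr χ̲ = 0` and `C₁ = 2 tr χ̲`, which is NOT zero — so the `∇₃A`-term of `ψ − ψ₀` carries no factor `a`; since `N_L = O(a)(…)`
the products estimated in §11.3.3 are `O(a)` either way [our reading: print precision, corrected in `[J]` at two of four places].
[cite: GiorgiKlainermanSzeftel2024, (11.1.4), p.478 L20–35, p.491 L27–41, p.492 L8, p.493 L66; GiorgiKlainermanSzeftel2022, l.20283–20287, l.20865–20877, l.20895] -/
theorem C1_a_zero (i x : K) : C1 i x 0 = 2 * x := by
  simp [C1]

/-- The Kerr values at `a = 0` of the quantities in `C₁`: `⁽ᵃ⁾tr χ̲ = 0` in either normalization, `tr χ̲ = −2(r − 2m)/r²` (outgoing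
normalization, `GRWTransformationAlgebra.trchbO`) resp. `−2/r` (ingoing, `trchbI`) — nonzero for `r ≠ 2m` resp. always.  (Loci of the
Kerr values in this module's FILE-page convention: outgoing `[J]` p.127 L130–141, ingoing p.124 L55–68 — the folios 126 / 123 that
`GRWTransformationAlgebra` cites; `[v1]` l.5734–5740 / l.5553–5558.)
[cite: GiorgiKlainermanSzeftel2024, p.127 L130–141, p.124 L55–68; GiorgiKlainermanSzeftel2022, l.5734–5740, l.5553–5558] -/
theorem trchb_a_zero (r m c : K) (hr : r ≠ 0) :
    atrchbO r 0 m c = 0 ∧ atrchbI r 0 c = 0 ∧ trchbO r 0 m c = -(2 * (r - 2 * m)) / r ^ 2 ∧ trchbI r 0 c = -2 / r := by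
  refine ⟨by simp [atrchbO], by simp [atrchbI], ?_, ?_⟩
  · unfold trchbO Del nsq
    field_simp
    ring
  · unfold trchbI nsq
    field_simp
    ring

end CoefficientC1

/-- Ledger summary: the exact (slack-`0`) slot uses of this part of Chapter 11 are `Morr`'s `r^{−1−δ}|∇₃ψ|²` in the `(Mor)` pairing,
`B_p[ψ]`'s far slot in the `(ext)` pairing, `B_q`'s far zeroth slot in Step 2a (`(q+5) − 8 = q − 3`) and `B_q`'s far `∇₄`-slot in
Step 2b (`q − 1`); every `A`-side use goes through Remark 11.2.2's display with slack `2` (`(Mor)`), `2 + δ − p ≥ 2δ` (`(ext)`) or `0`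
(Step 2b, one level up). [our reading] [cite: GiorgiKlainermanSzeftel2024, p.488 L30–62, p.489 L2–88, p.523 L9–204; GiorgiKlainermanSzeftel2022, l.20752–20803, l.22182–22212] -/
theorem exact_slot_uses (δ p q : ℚ) :
    morrNab3 δ - (-1 - δ) = 0 ∧ bPsiDk p 0 - (p - 3) = 0 ∧ bPsiZero q - ((q + 5) + 2 * ordN0) = 0 ∧ bPsiDk q 2 - (q - 1) = 0 ∧
    remNab3 δ - (1 + δ) = 2 ∧ remNab3 δ - (p + 1) = 2 + δ - p ∧ remNab3 q - (q + 3) = 0 := by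
  simp only [morrNab3_def, bPsiDk_def, bPsiZero_def, ordN0_def, (rem_defs δ).1, (rem_defs q).1]
  refine ⟨by ring, by ring, by ring, by ring, by ring, by ring, by ring⟩

end Literature.Geometry.Lorentzian.GiorgiKlainermanSzeftel2022.NTermWeightLedger
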